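import Literature.Probability.RandomPlanarGeometry.ConformalRestrictionLoewner
import Literature.Probability.RandomPlanarGeometry.SLERestrictionSimple
import Literature.Probability.RandomPlanarGeometry.SLEExistenceAt
import Literature.Probability.RandomPlanarGeometry.SLEUniquenessInLaw
import Literature.Probability.RandomPlanarGeometry.CritPercSLESimplePathProofs
import HarnessLib

/-!
# `LawlerSchrammWerner2003` at `κ = 8/3` only: the SLE₈ trace theorem is not needed

G. F. Lawler, O. Schramm, W. Werner, *Conformal restriction: the chordal case*, J. Amer. Math.
Soc. **16** (2003) 917–955, arXiv:math/0209343 (**[LSW]**, arXiv page numbers).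

Proof-only bookkeeping file for the named fact
`Literature.Probability.RandomPlanarGeometry.LawlerSchrammWerner2003` ([LSW] p. 5 result 2,
transposed; `ConformalRestriction`).

All previous assemblies (`ConformalRestrictionProofs.LawlerSchrammWerner2003_of_facts`, …,
`ConformalRestrictionLoewner.LawlerSchrammWerner2003_of_leaf_facts''''''`) obtain the SLE_{8/3}
family from the GLOBAL existence fact `exists_isSLECurve` ("for every `κ > 0`"), whose reduction
consumes the trace theorems for every `κ` — in particular `hasSLETrace_eight` (Lawler–Schramm–
Werner 2004, Thm. 4.7: SLE₈ is generated by a curve, via the uniform spanning tree) and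
`hasSLETrace_of_ne_eight` (Rohde–Schramm 2005, Thm. 5.1, all `κ ≠ 8`). The conclusion of the
target, `IsSLELaw (8/3) D (P D)`, only concerns `κ = 8/3`. This file re-assembles the target
along the same proof with every SLE input read at `κ = 8/3`:

* `ChordalFamily.spec_of_isSLELaw_eightThirds` / `LawlerSchrammWerner2003_of_facts_at` — the
  assembly of `ConformalRestrictionProofs` from the existence of an SLE_{8/3} curve in every
  Dobrushin domain (`hex : ∀ D, ∃ Γ, IsSLECurve (8/3) D Γ`) instead of `exists_isSLECurve`; uniqueness in
  law of chordal SLE is the theorem `IsSLECurve.map_eq_holds` (`SLEUniquenessInLaw`), the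
  Kolmogorov extension, Carathéodory and measurability inputs are theorems of the tree;
* `IsSLELaw.hullRestriction_eightThirds_of_local_leaf_facts` — [LSW] Thm. 6.1 transposed, from
  `HasSLETrace (8/3)`, transience, simplicity at `8/3`, the restriction martingale
  (Prop. 5.2/5.3) and Lemma 6.3 (Lemma 6.2 being proved in `RestrictionExitTime`,
  simple-curve form, as threaded in `SLERestrictionSimple`);
* `LawlerSchrammWerner2003_of_local_leaf_facts` — **the target from SEVEN named facts**:
  `HasSLETrace (8/3)` (Rohde–Schramm Thm. 5.1 at `κ = 8/3`), `tendsto_norm_sleTrace_atTop`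
  (RS Thm. 7.1), `ae_isSimpleTrace_sleTrace_of_le_four (κ = 8/3)` (RS Thm. 6.1), and from [LSW]:
  Prop. 5.2/5.3 (`sle_exists_isRestrictionMartingale`), Lemma 6.3
  (`IsSmoothHull.restrictionDerivVanishesAtHit`), Loewner's slit theorem behind Lemma 3.5
  (`IsArcHull.exists_loewner_chain`) and p. 5 result 2, first sentence = Thm. 7.3 / Cor. 8.6
  (`IsRestrictionMeasure.eq_five_eighths_of_outer_simple`). Neither `hasSLETrace_eight` nor
  [LSW] Lemma 6.2 nor Prop. 3.3 is a hypothesis any more;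
* `LawlerSchrammWerner2003_of_leaf_facts'''''''` — the same with `HasSLETrace (8/3)` fed by the
  printed Rohde–Schramm Thm. 5.1 (`hasSLETrace_of_ne_eight`, `8/3 ≠ 8`).
* `LawlerSchrammWerner2003_of_local_leaf_facts'` — **the target from SIX named facts**: the
  simplicity hypothesis is dropped, Rohde–Schramm's Thm. 6.1 at `κ = 8/3` being a theorem of the
  tree given `HasSLETrace (8/3)` (`ae_isSimpleTrace_sleTrace_of_hasSLETrace`,
  `CritPercSLESimplePathProofs`: non-swallowing of real points for `κ ≤ 4`, proved).

The transience hypothesis is still the global named fact `tendsto_norm_sleTrace_atTop` (all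
`κ > 0`), because it is threaded in that form through the proof of Thm. 6.1
(`SLERestrictionLemmas`, `LoewnerReflection`, `SLERestrictionSmooth`, `SLERestrictionSlidHull`,
`SLERestrictionSimple`, `HullRestrictionSLE`, `SLELawTransport`), each use being its instance at
`κ = 8/3`; localising it is a re-threading of those files left for a sequel.
-/

noncomputable section

open MeasureTheory Filter Topology
open scoped NNReal

namespace Literature.Probability.RandomPlanarGeometry

/-! ### The assembly of `ConformalRestrictionProofs` from SLE_{8/3} curves only -/

/-- **Existence half of [LSW] p. 5 result 2, assembled at `κ = 8/3`**: a chordal family `Q` all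
of whose laws are chordal SLE_{8/3} laws is chordal, conformally covariant, satisfies restriction
over hull subdomains and is carried by simple curves meeting the boundary only at the marked
points — given the transposed Thm. 6.1 (`h₄`) and Rohde–Schramm simplicity at `8/3` (`h₆`). As
`sleEightThirdsFamily_spec` (`ConformalRestrictionProofs`), with the Kolmogorov extension
(`isProjectiveLimit_preWienerMeasure_holds`), uniqueness in law of chordal SLE
(`IsSLECurve.map_eq_holds`), Carathéodory (`JordanDomain.exists_continuousOn_extension_holds`)
and Borel measurability of simple classes (`CurveClass.measurableSet_simple_holds`) supplied by
their proofs. [cite: LawlerSchrammWerner2003Restriction, Thm. 6.1 with [42] = Rohde–Schramm] -/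
theorem ChordalFamily.spec_of_isSLELaw_eightThirds {Q : ChordalFamily}
    (hQ : ∀ D : DobrushinDomain, IsSLELaw ((8 : ℝ≥0) / 3) D (Q D))
    (h₄ : IsSLELaw.hullRestriction_eightThirds)
    (h₆ : RandomPlanarGeometry.ae_isSimpleTrace_sleTrace_of_le_four (κ := (8 : ℝ≥0) / 3)) :
    Q.IsChordal ∧ Q.IsConformallyCovariant ∧ Q.IsHullRestriction ∧ Q.IsCarriedBySimpleCurves := by
  haveI : Fact Process.isProjectiveLimit_preWienerMeasure := ⟨isProjectiveLimit_preWienerMeasure_holds⟩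
  have hC : JordanDomain.exists_continuousOn_extension := JordanDomain.exists_continuousOn_extension_holds
  have h₅ : JordanDomain.exists_hasBoundaryValue := JordanDomain.exists_hasBoundaryValue_of_disc hC
  have h₈ : JordanDomain.mapsTo_boundaryExtension := JordanDomain.mapsTo_boundaryExtension_of_disc hC
  refine ⟨fun D ↦ ⟨(hQ D).isProbabilityMeasure, (hQ D).ae_endpoints h₈⟩,
    fun D D' g Φ h0 h1 hΦ ↦
      IsSLELaw.conformalCovariance_of_facts IsSLECurve.map_eq_holds h₅ D D' g Φ (hQ D) (hQ D')
        h0 h1 hΦ,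
    fun D D' hDD' T hT ↦ h₄ D D' (hQ D) (hQ D') hDD' T hT,
    fun D ↦ (hQ D).ae_simple h₆ CurveClass.measurableSet_simple_holds (by positivity) ?_⟩
  rw [div_le_iff₀ (by norm_num : (0 : ℝ≥0) < 3)]
  norm_num

/-- **`LawlerSchrammWerner2003` from its parts, at `κ = 8/3`**: as
`LawlerSchrammWerner2003_of_facts` (`ConformalRestrictionProofs`), from the existence of an
SLE_{8/3} curve in every Dobrushin domain (`hex`, instead of the global `exists_isSLECurve`),
uniqueness of the restriction family carried by simple curves (`hU`), the transposed Thm. 6.1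
(`h₄`) and simplicity at `8/3` (`h₆`); every other input of that assembly is a theorem of the
tree. Proof: choose SLE_{8/3} curves `Γ D`; the family of their laws has the four properties
(`ChordalFamily.spec_of_isSLELaw_eightThirds`); a family as in the statement satisfies
restriction over hull subdomains a fortiori, so it agrees with that family in every domain.
[cite: LawlerSchrammWerner2003Restriction, p. 5 result 2] -/
theorem LawlerSchrammWerner2003_of_facts_at
    (hex : ∀ D : DobrushinDomain, ∃ Γ, IsSLECurve ((8 : ℝ≥0) / 3) D Γ)
    (hU : LawlerSchrammWerner2003_unique) (h₄ : IsSLELaw.hullRestriction_eightThirds)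
    (h₆ : RandomPlanarGeometry.ae_isSimpleTrace_sleTrace_of_le_four (κ := (8 : ℝ≥0) / 3)) :
    LawlerSchrammWerner2003 := by
  choose Γ hΓ using hex
  have hQ : ∀ D : DobrushinDomain,
      IsSLELaw ((8 : ℝ≥0) / 3) D ((fun D' ↦ Process.preWienerMeasure.map (Γ D')) D) :=
    fun D ↦ (hΓ D).isSLELaw_map
  intro P hP hcov hres hsimple D
  obtain ⟨hQc, hQcov, hQres, hQs⟩ := ChordalFamily.spec_of_isSLELaw_eightThirds hQ h₄ h₆
  have hPres : P.IsHullRestriction := ChordalFamily.IsRestriction.isHullRestriction hres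
  rw [hU P _ hP hcov hPres hsimple hQc hQcov hQres hQs D]
  exact hQ D

/-! ### [LSW] Thm. 6.1 transposed, at `κ = 8/3` -/

/-- **[LSW] Thm. 6.1 transposed to Dobrushin domains, from five leaf facts read at `κ = 8/3`**:
as `IsSLELaw.hullRestriction_eightThirds_of_leaf_facts'` (`SLERestrictionSimple`; Lemma 6.2 proved),
with `HasSLETrace (8/3)` (`hgen`) in place of the pair `hasSLETrace_eight`,
`hasSLETrace_of_ne_eight`, and uniqueness in law of chordal SLE supplied by
`IsSLECurve.map_eq_holds` instead of SLE scaling for all `κ`.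
[cite: LawlerSchrammWerner2003Restriction, Thm. 6.1 (p. 23) and its proof (§6), with Prop. 3.3 (p. 11)] -/
theorem IsSLELaw.hullRestriction_eightThirds_of_local_leaf_facts
    (hgen : HasSLETrace ((8 : ℝ≥0) / 3)) (htr : tendsto_norm_sleTrace_atTop)
    (h₆ : RandomPlanarGeometry.ae_isSimpleTrace_sleTrace_of_le_four (κ := (8 : ℝ≥0) / 3))
    (hM : sle_exists_isRestrictionMartingale) (h63 : IsSmoothHull.restrictionDerivVanishesAtHit) :
    IsSLELaw.hullRestriction_eightThirds := by
  haveI : Fact Process.isProjectiveLimit_preWienerMeasure := ⟨isProjectiveLimit_preWienerMeasure_holds⟩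
  have hC : JordanDomain.exists_continuousOn_extension := JordanDomain.exists_continuousOn_extension_holds
  have h61 : sle_restriction_eightThirds :=
    sle_restriction_eightThirds_of_printed_facts' IsStarHull.existsUnique_isRestrictionMap_holds
      IsStarHull.exists_hasRestrictionDeriv_holds hM h63
      IsPlusHull.exists_antitone_isSmoothHull_holds hgen h₆ htr
      sle_swallowingTime_ofReal_eq_firstHit_holds (aemeasurable_sleTrace_holds hgen)
  exact IsSLELaw.hullRestriction_eightThirds_of_facts h61
    IsStarHull.existsUnique_isRestrictionMap_holds IsStarHull.exists_hasRestrictionDeriv_holds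
    HasRestrictionDeriv.tendsto_of_kernel_holds isSimplyConnected_of_isConnected_compl_holds
    JordanDomain.isSimplyConnected_holds Literature.Topology.PlaneTopology.JordanCurveTheorem_holds
    Literature.Topology.PlaneTopology.JordanArcSeparation_holds exists_conformalEquiv_ball_holds hC
    hgen h₆ htr IsSLECurve.map_eq_holds aemeasurable_sleTrace_holds

/-! ### The uniqueness half, from Loewner's slit theorem and Cor. 8.6 -/

/-- **[LSW] p. 5 result 2, uniqueness half, from two leaf facts**: `LawlerSchrammWerner2003_unique`
from Loewner's slit theorem (`hL`, behind the density clause of Lemma 3.5, hence Prop. 3.3 by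
`exists_isRestrictionMeasure_of_isHullMultiplicative_of_loewner`) and Thm. 7.3 / Cor. 8.6
(`h58`); the Jordan curve theorem, arc non-separation, Carathéodory, Riemann mapping and the
[LSW] §2 facts are theorems of the tree (as in `LawlerSchrammWerner2003_unique_of_facts'`).
[cite: LawlerSchrammWerner2003Restriction, p. 5 result 2 with Prop. 3.3, Lemma 3.5 and Cor. 8.6] -/
theorem LawlerSchrammWerner2003_unique_of_loewner (hL : IsArcHull.exists_loewner_chain)
    (h58 : IsRestrictionMeasure.eq_five_eighths_of_outer_simple) : LawlerSchrammWerner2003_unique :=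
  LawlerSchrammWerner2003_unique_of_facts' Literature.Topology.PlaneTopology.JordanCurveTheorem_holds
    Literature.Topology.PlaneTopology.JordanArcSeparation_holds
    JordanDomain.exists_continuousOn_extension_holds JordanDomain.isSimplyConnected_holds
    exists_conformalEquiv_ball_holds IsStarHull.existsUnique_isRestrictionMap_holds
    IsStarHull.exists_hasRestrictionDeriv_holds isSimplyConnected_of_isConnected_compl_holds
    IsStarHull.exists_isHullProduct_plus_minus_holds
    (exists_isRestrictionMeasure_of_isHullMultiplicative_of_loewner hL) h58

/-! ### The target from seven leaf facts, all SLE inputs at `κ = 8/3` -/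

/-- **[LSW] p. 5 result 2 (transposed) from SEVEN leaf facts, every SLE input at `κ = 8/3`.**
Hypotheses: SLE_{8/3} is generated by a curve (`hgen`, Rohde–Schramm (2005) Thm. 5.1 at
`κ = 8/3`); transience of the SLE trace (`htr`, RS05 Thm. 7.1); the SLE_{8/3} trace is simple
(`h₆`, RS05 Thm. 6.1); and from [LSW]: the restriction martingale `h_t'(W_t)^{5/8}` (`hM`,
Prop. 5.2/5.3), Lemma 6.3 (`h63`), Loewner's slit theorem behind the density clause of Lemma 3.5
(`hL`) and p. 5 result 2, first sentence = Thm. 7.3 / Cor. 8.6 (`h58`). Everything else —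
[LSW] §2, Prop. 3.3, Lemma 3.5 (continuity, and density given `hL`), Lemma 2.1, Lemma 6.2, the
transposition (Riemann mapping, Carathéodory, Jordan curve theorem, Kolmogorov extension,
uniqueness in law of chordal SLE) — is a theorem of the tree. Proof: SLE_{8/3} curves exist in
every Dobrushin domain by `exists_isSLECurve_at` (from `hgen`, `htr` at `8/3`); conclude by
`LawlerSchrammWerner2003_of_facts_at`.
[cite: LawlerSchrammWerner2003Restriction, p. 5 result 2 with Prop. 3.3, Lemma 3.5, Prop. 5.2, Lemma 6.3, Thm. 6.1, Thm. 7.3, Cor. 8.6] -/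
theorem LawlerSchrammWerner2003_of_local_leaf_facts (hgen : HasSLETrace ((8 : ℝ≥0) / 3))
    (htr : tendsto_norm_sleTrace_atTop)
    (h₆ : RandomPlanarGeometry.ae_isSimpleTrace_sleTrace_of_le_four (κ := (8 : ℝ≥0) / 3))
    (hM : sle_exists_isRestrictionMartingale) (h63 : IsSmoothHull.restrictionDerivVanishesAtHit)
    (hL : IsArcHull.exists_loewner_chain)
    (h58 : IsRestrictionMeasure.eq_five_eighths_of_outer_simple) : LawlerSchrammWerner2003 :=
  LawlerSchrammWerner2003_of_facts_at
    (fun D ↦ exists_isSLECurve_at hgen (htr (by positivity)) D)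
    (LawlerSchrammWerner2003_unique_of_loewner hL h58)
    (IsSLELaw.hullRestriction_eightThirds_of_local_leaf_facts hgen htr h₆ hM h63) h₆

/-- **[LSW] p. 5 result 2 (transposed) from SEVEN printed facts** — as
`LawlerSchrammWerner2003_of_local_leaf_facts` with `HasSLETrace (8/3)` fed by the printed
Rohde–Schramm Thm. 5.1 (`hne : hasSLETrace_of_ne_eight`, since `8/3 ≠ 8`). Compared with
`LawlerSchrammWerner2003_of_leaf_facts''''''` (`ConformalRestrictionLoewner`, nine facts): the
SLE₈ trace theorem `hasSLETrace_eight` (Lawler–Schramm–Werner 2004, Thm. 4.7) and [LSW]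
Lemma 6.2 (`Loewner.restrictionDeriv_exitTime_gt`, proved in `RestrictionExitTime`) are gone.
[cite: LawlerSchrammWerner2003Restriction, p. 5 result 2 with Prop. 3.3, Lemma 3.5, Prop. 5.2, Lemma 6.3, Thm. 6.1, Thm. 7.3, Cor. 8.6] -/
theorem LawlerSchrammWerner2003_of_leaf_facts''''''' (hne : hasSLETrace_of_ne_eight)
    (htr : tendsto_norm_sleTrace_atTop)
    (h₆ : RandomPlanarGeometry.ae_isSimpleTrace_sleTrace_of_le_four (κ := (8 : ℝ≥0) / 3))
    (hM : sle_exists_isRestrictionMartingale) (h63 : IsSmoothHull.restrictionDerivVanishesAtHit)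
    (hL : IsArcHull.exists_loewner_chain)
    (h58 : IsRestrictionMeasure.eq_five_eighths_of_outer_simple) : LawlerSchrammWerner2003 :=
  LawlerSchrammWerner2003_of_local_leaf_facts (hne (by norm_num)) htr h₆ hM h63 hL h58

/-! ### Six leaf facts: simplicity at `κ = 8/3` is a theorem given the trace -/

/-- **Rohde–Schramm (2005), Thm. 6.1 at `κ = 8/3` from trace existence at `8/3`**: the named fact
`ae_isSimpleTrace_sleTrace_of_le_four (κ := 8/3)` follows from `HasSLETrace (8/3)` by
`ae_isSimpleTrace_sleTrace_of_hasSLETrace` (`CritPercSLESimplePathProofs`; the non-swallowing of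
positive reals for `κ ≤ 4`, Lawler (2005) Prop. 6.8, is proved there). [cite: RohdeSchramm2005, Thm 6.1] -/
theorem ae_isSimpleTrace_sleTrace_eightThirds_of_hasSLETrace (hgen : HasSLETrace ((8 : ℝ≥0) / 3)) :
    RandomPlanarGeometry.ae_isSimpleTrace_sleTrace_of_le_four (κ := (8 : ℝ≥0) / 3) :=
  fun _ h4 ↦ ae_isSimpleTrace_sleTrace_of_hasSLETrace hgen h4

/-- **[LSW] p. 5 result 2 (transposed) from SIX leaf facts, every SLE input at `κ = 8/3`.**
As `LawlerSchrammWerner2003_of_local_leaf_facts`, with the simplicity of the SLE_{8/3} trace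
(Rohde–Schramm Thm. 6.1) supplied by `ae_isSimpleTrace_sleTrace_eightThirds_of_hasSLETrace`.
Remaining hypotheses: SLE_{8/3} is generated by a curve (`hgen`, Rohde–Schramm (2005) Thm. 5.1
at `κ = 8/3`); transience of the SLE trace (`htr`, RS05 Thm. 7.1, all `κ > 0` — used at `8/3`
only, but threaded globally through the proof of [LSW] Thm. 6.1); and from [LSW]: the restriction
martingale (`hM`, Prop. 5.2/5.3), Lemma 6.3 (`h63`), Loewner's slit theorem behind Lemma 3.5
(`hL`) and Thm. 7.3 / Cor. 8.6 (`h58`).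
[cite: LawlerSchrammWerner2003Restriction, p. 5 result 2 with Prop. 3.3, Lemma 3.5, Prop. 5.2, Lemma 6.3, Thm. 6.1, Thm. 7.3, Cor. 8.6] -/
theorem LawlerSchrammWerner2003_of_local_leaf_facts' (hgen : HasSLETrace ((8 : ℝ≥0) / 3))
    (htr : tendsto_norm_sleTrace_atTop) (hM : sle_exists_isRestrictionMartingale)
    (h63 : IsSmoothHull.restrictionDerivVanishesAtHit) (hL : IsArcHull.exists_loewner_chain)
    (h58 : IsRestrictionMeasure.eq_five_eighths_of_outer_simple) : LawlerSchrammWerner2003 :=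
  LawlerSchrammWerner2003_of_local_leaf_facts hgen htr
    (ae_isSimpleTrace_sleTrace_eightThirds_of_hasSLETrace hgen) hM h63 hL h58

end Literature.Probability.RandomPlanarGeometry

end
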